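import Summits.QuantumFields.GaugeBoot.PeriodicSchwingerDyson
import Summits.QuantumFields.GaugeBoot.LoopEquation
import HarnessLib

/-!
# The single-link loop equation for lattice `SU(N)` / `U(N)` on a periodic lattice (gauge-boot, periodic loop equations 5/5)

HONEST FRAMING (cell `pub-gaugeboot`, page 1 of every file): the venture produces certified bounds
on lattice expectations at stated coupling, gauge group, dimension and torus size; NOT a mass gap,
NOT a continuum limit, NOT a string tension; NOT Yang–Mills-summit-bearing (barriers
`FixedCouplingUltralocality`, `PerturbativeInvisibility`).

File 5/5 of the re-typing of the tree's loop-equation stack over the periodic lattice `(A, e)` of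
`TiltedLatticeGauge.lean` (Wilson measure `μ_β = gibbs ρ e β`); the verbatim analogue of
`LoopEquation.lean`, whose matrix-only contraction lemmas (`unitDir`, `sum_trace_unitDir_sandwich`,
`sum_trace_mul_trace_unitDir`, `trace_unitDir_one`, `sum₄_comm`) are reused. Result, for every
finite additive site group `A` with translations `e : Fin d → A` (the cubic torus `(ℤ/L)^d` and the
45°-tilted box `TiltedSite d i j M_u M_v L` with `tiltedUnit` are instances), every link `(x, μ)`,
every real `β` and every word `w` CLOSED at `x`:

  `Σ_{k<|w|} E[splitTerm_k] + (β/2)·Σ_{ν≠μ} Σ_{ε=±} E[plaqTerm_{ν,ε}] = 0`   (`loopEquation_of_sdPair`)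

with `splitTerm_k = tr ρ(hol w[0,k))·tr ρ(hol w[k,n)) − (s/N) tr ρ(hol w)` at a forward traversal of the
link by the `k`-th letter (minus the analogous product at a backward one) and `plaqTerm_{ν,ε} =
tr ρ(hol(w·P̃)) − tr ρ(hol(w·P̃⁻¹)) − (s/N) tr ρ(hol w)(tr ρ(hol P̃) − tr ρ(hol P̃⁻¹))`, `P̃ = P̃_{ν,ε}` the
plaquette through the link re-oriented to start with it. Specialisations:
**`loopEquation_specialUnitaryGroup`** (`G = SU(N)`, fundamental representation, `s = 1`) and
**`loopEquation_unitaryGroup`** (`s = 0`). This is the cell's L1 standard ("the loop equation is a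
lemma, never silent") on the periodic-lattice type, i.e. condition (a) of the tribunal's largest
honest target item (4) (t1.md v2.3 A8/A13/A15) for certificates on the tilted box: Kazakov–Zheng's
`A_id + A_split + A_join + A_var` equation (arXiv:2404.16925 §2.3; JHEP 03 (2025) 099, eq. (2.26)–(2.30)) as an unconditional theorem
about ANY finite periodic lattice. Everything is `[folklore]` given file 4/5.

References: V. Kazakov, Z. Zheng, arXiv:2203.11360 §2 (large `N`), arXiv:2404.16925 §2.3 (finite `N`, multi-trace); S. Cao,
M. Park, S. Sheffield, Comm. AMS 5 (2025), Thm. 5.7 (`U(N)`) / Thm. 6.104 (`SU(N)`) (arXiv:2307.06790 numbering; informally Thm. 1.14)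
(loop equations on a general finite graph); S. Chatterjee,
arXiv:1502.07719 §3.
-/

noncomputable section

open MeasureTheory Filter Topology NormedSpace
open scoped Matrix.Norms.Frobenius Matrix
open Literature.MathematicalPhysics.QuantumFieldTheory (LatticeRep)

namespace Summit.QuantumFields.GaugeBoot

namespace TiltedRP

variable {A : Type} [AddCommGroup A] [DecidableEq A] {d N : ℕ} {G : Type} [Group G]
  {ρ : G →* Matrix (Fin N) (Fin N) ℂ} (e : Fin d → A)

section SplitTerms

variable (ρ) in
/-- The `k`-th SPLIT TERM of the loop equation for the word `w` read from `x` and the link `(x, μ)`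
(weight `s`): at a forward traversal of the link by the `k`-th letter,
`tr ρ(hol w[0,k)) · tr ρ(hol w[k,n)) − (s/N) tr ρ(hol w)`; at a backward one,
`−(tr ρ(hol w[0,k]) · tr ρ(hol w(k,n)) − (s/N) tr ρ(hol w))`; else `0`. [folklore] -/
def splitTerm (s : ℂ) (x : A) (μ : Fin d) (U : Config A d G) (w : Word d) (k : ℕ) : ℂ :=
  match w[k]? with
  | none => 0
  | some st =>
    if st.link e (Word.siteAt e x w k) = (x, μ) then
      (if st.isFwd then
        (ρ (wordHolonomy e U x (w.take k))).trace *
            (ρ (wordHolonomy e U (Word.siteAt e x w k) (w.drop k))).trace -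
          (s / N) * (ρ (wordHolonomy e U x w)).trace
      else
        -((ρ (wordHolonomy e U x (w.take (k + 1)))).trace *
            (ρ (wordHolonomy e U (Word.siteAt e x w (k + 1)) (w.drop (k + 1)))).trace -
          (s / N) * (ρ (wordHolonomy e U x w)).trace))
    else 0

/-- Contracting the occurrence terms over the matrix units gives the split term. [folklore] -/
theorem sum_occTerm_unitDir (s : ℂ) (x : A) (μ : Fin d) (U : Config A d G) (w : Word d) (k : ℕ) :
    ∑ i : Fin N, ∑ j : Fin N, occTerm ρ e (x, μ) (unitDir s i j) (Matrix.single j i 1) U x w k =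
      splitTerm ρ e s x μ U w k := by
  unfold occTerm splitTerm
  cases w[k]? with
  | none => simp
  | some st =>
    simp only
    split_ifs
    · rw [sum_trace_unitDir_sandwich, ← map_mul, wordHolonomy_take_drop]
    · simp only [Finset.sum_neg_distrib, sum_trace_unitDir_sandwich, ← map_mul, wordHolonomy_take_drop]
    · simp

/-- **Contracted left side, pointwise**: `Σ_ij tr(E_ji · insDeriv_{X_ij} hol_w) = Σ_k splitTerm_k`.
[folklore] -/
theorem sum_trace_insDeriv_unitDir (s : ℂ) (x : A) (μ : Fin d) (U : Config A d G) (w : Word d) :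
    ∑ i : Fin N, ∑ j : Fin N,
        (Matrix.single j i (1 : ℂ) * insDeriv ρ e (x, μ) (unitDir s i j) U x w).trace =
      ∑ k ∈ Finset.range w.length, splitTerm ρ e s x μ U w k := by
  simp only [trace_mul_insDeriv]
  calc ∑ i : Fin N, ∑ j : Fin N, ∑ k ∈ Finset.range w.length,
        occTerm ρ e (x, μ) (unitDir s i j) (Matrix.single j i 1) U x w k
      = ∑ i : Fin N, ∑ k ∈ Finset.range w.length, ∑ j : Fin N,
          occTerm ρ e (x, μ) (unitDir s i j) (Matrix.single j i 1) U x w k :=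
        Finset.sum_congr rfl fun _ _ => Finset.sum_comm
    _ = ∑ k ∈ Finset.range w.length, ∑ i : Fin N, ∑ j : Fin N,
          occTerm ρ e (x, μ) (unitDir s i j) (Matrix.single j i 1) U x w k := Finset.sum_comm
    _ = ∑ k ∈ Finset.range w.length, splitTerm ρ e s x μ U w k :=
        Finset.sum_congr rfl fun k _ => sum_occTerm_unitDir e s x μ U w k

variable (ρ) in
omit [DecidableEq A] in
/-- The PLAQUETTE TERM of the loop equation for `(ν, ε)`:
`tr ρ(hol(w·P̃)) − tr ρ(hol(w·P̃⁻¹)) − (s/N)·tr ρ(hol w)·(tr ρ(hol P̃) − tr ρ(hol P̃⁻¹))` with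
`P̃ = plaqWord μ ν ε`. [folklore] -/
def plaqTerm (s : ℂ) (x : A) (μ : Fin d) (U : Config A d G) (w : Word d) (ν : Fin d) (ε : Bool) : ℂ :=
  (ρ (wordHolonomy e U x (w ++ plaqWord μ ν ε))).trace -
      (ρ (wordHolonomy e U x (w ++ (plaqWord μ ν ε).reverse))).trace -
    (s / N) * ((ρ (wordHolonomy e U x w)).trace *
      ((ρ (wordHolonomy e U x (plaqWord μ ν ε))).trace -
        (ρ (wordHolonomy e U x (plaqWord μ ν ε).reverse)).trace))

omit [DecidableEq A] in
/-- **Contracted right side, pointwise**: `Σ_ij tr(E_ji ρ(hol_w))·(−½ plaqIns_{X_ij}) =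
−½ Σ_{ν≠μ,ε} plaqTerm_{ν,ε}` (for a word closed at the source `x` of the link). [folklore] -/
theorem sum_trace_mul_plaqIns_unitDir (s : ℂ) (x : A) (μ : Fin d) (U : Config A d G) (w : Word d)
    (hw : Word.endpoint e x w = x) :
    ∑ i : Fin N, ∑ j : Fin N, (Matrix.single j i (1 : ℂ) * ρ (wordHolonomy e U x w)).trace *
        (-(1 / 2) * plaqIns ρ e (unitDir s i j) U x μ) =
      -(1 / 2) * ∑ ν ∈ Finset.univ.erase μ, ∑ ε : Bool, plaqTerm ρ e s x μ U w ν ε := by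
  unfold plaqIns
  simp only [Finset.mul_sum]
  rw [sum₄_comm]
  refine Finset.sum_congr rfl fun ν _ => Finset.sum_congr rfl fun ε _ => ?_
  calc ∑ i : Fin N, ∑ j : Fin N, (Matrix.single j i (1 : ℂ) * ρ (wordHolonomy e U x w)).trace *
        (-(1 / 2) * (unitDir s i j * (ρ (wordHolonomy e U x (plaqWord μ ν ε)) -
          ρ (wordHolonomy e U x (plaqWord μ ν ε).reverse))).trace)
      = -(1 / 2) * ∑ i : Fin N, ∑ j : Fin N, (Matrix.single j i (1 : ℂ) * ρ (wordHolonomy e U x w)).trace *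
          (unitDir s i j * (ρ (wordHolonomy e U x (plaqWord μ ν ε)) -
            ρ (wordHolonomy e U x (plaqWord μ ν ε).reverse))).trace := by
        simp only [Finset.mul_sum]
        exact Finset.sum_congr rfl fun i _ => Finset.sum_congr rfl fun j _ => by ring
    _ = -(1 / 2) * plaqTerm ρ e s x μ U w ν ε := by
        rw [sum_trace_mul_trace_unitDir, plaqTerm, Matrix.mul_sub, Matrix.trace_sub, Matrix.trace_sub,
          ← map_mul, ← map_mul, ← wordHolonomy_append_closed e U x w _ hw,
          ← wordHolonomy_append_closed e U x w _ hw]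

end SplitTerms

section Assembly

variable [TopologicalSpace G] [IsTopologicalGroup G] (r : LatticeRep G)

omit [DecidableEq A] in
/-- Continuity of `U ↦ tr ρ(hol_w U)`. [folklore] -/
theorem continuous_trace_wordHolonomy (x : A) (w : Word d) :
    Continuous fun U : Config A d G => (r.ρ (wordHolonomy e U x w)).trace :=
  (r.continuous.comp (continuous_wordHolonomy e x w)).matrix_trace

/-- Continuity of the split terms. [folklore] -/
theorem continuous_splitTerm (s : ℂ) (x : A) (μ : Fin d) (w : Word d) (k : ℕ) :
    Continuous fun U : Config A d G => splitTerm r.ρ e s x μ U w k := by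
  unfold splitTerm
  cases w[k]? with
  | none => exact continuous_const
  | some st =>
    simp only
    split_ifs
    · exact ((continuous_trace_wordHolonomy e r x _).mul (continuous_trace_wordHolonomy e r _ _)).sub
        (continuous_const.mul (continuous_trace_wordHolonomy e r x w))
    · exact (((continuous_trace_wordHolonomy e r x _).mul (continuous_trace_wordHolonomy e r _ _)).sub
        (continuous_const.mul (continuous_trace_wordHolonomy e r x w))).neg
    · exact continuous_const

omit [DecidableEq A] in
/-- Continuity of the plaquette terms. [folklore] -/
theorem continuous_plaqTerm (s : ℂ) (x : A) (μ : Fin d) (w : Word d) (ν : Fin d) (ε : Bool) :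
    Continuous fun U : Config A d G => plaqTerm r.ρ e s x μ U w ν ε := by
  unfold plaqTerm
  exact ((continuous_trace_wordHolonomy e r x _).sub (continuous_trace_wordHolonomy e r x _)).sub
    (continuous_const.mul ((continuous_trace_wordHolonomy e r x w).mul
      ((continuous_trace_wordHolonomy e r x _).sub (continuous_trace_wordHolonomy e r x _))))

variable [Fintype A] [CompactSpace G] [MeasurableSpace G] [BorelSpace G]

/-- **THE SINGLE-LINK LOOP EQUATION ON A PERIODIC LATTICE (abstract form).** Let `G` be compact with
lattice representation `r`, `(A, e)` a finite periodic lattice, `β` real, `(x, μ)` a link, `w` a word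
CLOSED at `x`, and `s ∈ ℂ` a weight such that every direction `X_ij = E_ij − (s/N)δ_ij·1` satisfies
the pair identity. Then `Σ_k E[splitTerm_k] + (β/2)·Σ_{ν≠μ} Σ_{ε=±} E[plaqTerm_{ν,ε}] = 0`,
`E` the expectation in `gibbs r.ρ e β`. [folklore] -/
theorem loopEquation_of_sdPair (β : ℝ) (x : A) (μ : Fin d) (s : ℂ) (w : Word d)
    (hw : Word.endpoint e x w = x) (hP : ∀ i j : Fin r.N, SDPair r e β x μ x w (unitDir s i j)) :
    (∑ k ∈ Finset.range w.length, ∫ U, splitTerm r.ρ e s x μ U w k ∂(gibbs r.ρ e β)) +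
      (β / 2 : ℂ) * ∑ ν ∈ Finset.univ.erase μ, ∑ ε : Bool,
        ∫ U, plaqTerm r.ρ e s x μ U w ν ε ∂(gibbs r.ρ e β) = 0 := by
  set μW := gibbs r.ρ e β with hμW
  have hf : ∀ i j : Fin r.N, Integrable
      (fun U => (Matrix.single j i (1 : ℂ) * insDeriv r.ρ e (x, μ) (unitDir s i j) U x w).trace) μW :=
    fun i j => integrable_of_continuous_gibbs r e β (continuous_trace_mul_insDeriv r e _ _ (x, μ) x w)
  have hg : ∀ i j : Fin r.N, Integrable (fun U => (Matrix.single j i (1 : ℂ) *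
      r.ρ (wordHolonomy e U x w)).trace * (-(1 / 2) * plaqIns r.ρ e (unitDir s i j) U x μ)) μW :=
    fun i j => integrable_of_continuous_gibbs r e β (continuous_rhsIntegrand r e _ _ x μ x w)
  have h1 : ∫ U, ∑ k ∈ Finset.range w.length, splitTerm r.ρ e s x μ U w k ∂μW =
      (β : ℂ) * ∫ U, -(1 / 2) * ∑ ν ∈ Finset.univ.erase μ, ∑ ε : Bool,
        plaqTerm r.ρ e s x μ U w ν ε ∂μW := by
    calc ∫ U, ∑ k ∈ Finset.range w.length, splitTerm r.ρ e s x μ U w k ∂μW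
        = ∫ U, ∑ i : Fin r.N, ∑ j : Fin r.N,
            (Matrix.single j i (1 : ℂ) * insDeriv r.ρ e (x, μ) (unitDir s i j) U x w).trace ∂μW :=
          integral_congr_ae (ae_of_all _ fun U => (sum_trace_insDeriv_unitDir e s x μ U w).symm)
      _ = ∑ i : Fin r.N, ∑ j : Fin r.N,
            ∫ U, (Matrix.single j i (1 : ℂ) * insDeriv r.ρ e (x, μ) (unitDir s i j) U x w).trace ∂μW := by
          rw [integral_finsetSum _ fun i _ => integrable_finsetSum _ fun j _ => hf i j]
          exact Finset.sum_congr rfl fun i _ => integral_finsetSum _ fun j _ => hf i j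
      _ = ∑ i : Fin r.N, ∑ j : Fin r.N, (β : ℂ) *
            ∫ U, (Matrix.single j i (1 : ℂ) * r.ρ (wordHolonomy e U x w)).trace *
              (-(1 / 2) * plaqIns r.ρ e (unitDir s i j) U x μ) ∂μW :=
          Finset.sum_congr rfl fun i _ => Finset.sum_congr rfl fun j _ => hP i j (Matrix.single j i 1)
      _ = (β : ℂ) * ∑ i : Fin r.N, ∑ j : Fin r.N,
            ∫ U, (Matrix.single j i (1 : ℂ) * r.ρ (wordHolonomy e U x w)).trace *
              (-(1 / 2) * plaqIns r.ρ e (unitDir s i j) U x μ) ∂μW := by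
          simp only [Finset.mul_sum]
      _ = (β : ℂ) * ∫ U, ∑ i : Fin r.N, ∑ j : Fin r.N,
            (Matrix.single j i (1 : ℂ) * r.ρ (wordHolonomy e U x w)).trace *
              (-(1 / 2) * plaqIns r.ρ e (unitDir s i j) U x μ) ∂μW := by
          rw [integral_finsetSum _ fun i _ => integrable_finsetSum _ fun j _ => hg i j]
          congr 1
          exact (Finset.sum_congr rfl fun i _ => integral_finsetSum _ fun j _ => hg i j).symm
      _ = (β : ℂ) * ∫ U, -(1 / 2) * ∑ ν ∈ Finset.univ.erase μ, ∑ ε : Bool,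
            plaqTerm r.ρ e s x μ U w ν ε ∂μW := by
          congr 1
          exact integral_congr_ae (ae_of_all _ fun U => sum_trace_mul_plaqIns_unitDir e s x μ U w hw)
  have h2 : ∫ U, ∑ k ∈ Finset.range w.length, splitTerm r.ρ e s x μ U w k ∂μW =
      ∑ k ∈ Finset.range w.length, ∫ U, splitTerm r.ρ e s x μ U w k ∂μW :=
    integral_finsetSum _ fun k _ => integrable_of_continuous_gibbs r e β (continuous_splitTerm e r s x μ w k)
  have h3 : ∫ U, -(1 / 2) * ∑ ν ∈ Finset.univ.erase μ, ∑ ε : Bool, plaqTerm r.ρ e s x μ U w ν ε ∂μW =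
      -(1 / 2) * ∑ ν ∈ Finset.univ.erase μ, ∑ ε : Bool, ∫ U, plaqTerm r.ρ e s x μ U w ν ε ∂μW := by
    rw [integral_const_mul]
    congr 1
    rw [integral_finsetSum _ fun ν _ => integrable_finsetSum _ fun ε _ =>
      integrable_of_continuous_gibbs r e β (continuous_plaqTerm e r s x μ w ν ε)]
    exact Finset.sum_congr rfl fun ν _ => integral_finsetSum _ fun ε _ =>
      integrable_of_continuous_gibbs r e β (continuous_plaqTerm e r s x μ w ν ε)
  rw [← h2, h1, h3]
  ring

end Assembly

section Concrete

open Literature.MathematicalPhysics.QuantumLattice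

variable [Fintype A]

/-- **`SU(N)` on a periodic lattice: every traceless direction satisfies the pair identity** — a
traceless skew-Hermitian `X` generates the one-parameter subgroup `t ↦ exp(tX)` of `SU(N)` (tree
`mem_oneParamGenerators_specialUnitaryGroup`), then polarisation. [folklore] -/
theorem sdPair_specialUnitaryGroup (N : ℕ) (e : Fin d → A) (β : ℝ) (x : A) (μ : Fin d) (x₀ : A)
    (w : Word d) (X : Matrix (Fin N) (Fin N) ℂ) (hX : X.trace = 0) :
    SDPair (fundamentalLatticeRep N) e β x μ x₀ w X := by
  refine sdPair_of_traceless (fundamentalLatticeRep N) e β x μ x₀ w (fun X hXs hX0 => ?_) X hX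
  have hmem := mem_oneParamGenerators_specialUnitaryGroup (n := Fin N) (X := X) hXs hX0
  refine sdPair_of_oneParam (fundamentalLatticeRep N) e β x μ x₀ w hXs
    (k := fun t => ⟨NormedSpace.exp (t • X), hmem t⟩) (fun a b => Subtype.ext ?_) (fun t => ?_)
  · change NormedSpace.exp ((a + b) • X) = NormedSpace.exp (a • X) * NormedSpace.exp (b • X)
    rw [add_smul]
    exact Matrix.exp_add_of_commute _ _ (((Commute.refl X).smul_left a).smul_right b)
  · change NormedSpace.exp (t • X) = NormedSpace.exp ((t : ℂ) • X)
    rw [Complex.coe_smul]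

/-- **`U(N)` on a periodic lattice: every direction satisfies the pair identity** — a skew-Hermitian
`X` generates the one-parameter subgroup `t ↦ exp(tX)` of `U(N)` (tree
`mem_oneParamGenerators_unitaryGroup`), then polarisation. [folklore] -/
theorem sdPair_unitaryGroup (N : ℕ) (e : Fin d → A) (β : ℝ) (x : A) (μ : Fin d) (x₀ : A) (w : Word d)
    (X : Matrix (Fin N) (Fin N) ℂ) : SDPair (unitaryFundamentalLatticeRep N) e β x μ x₀ w X := by
  refine sdPair_of_skew (unitaryFundamentalLatticeRep N) e β x μ x₀ w (fun X hXs => ?_) X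
  have hmem := mem_oneParamGenerators_unitaryGroup (n := Fin N) (X := X) hXs
  refine sdPair_of_oneParam (unitaryFundamentalLatticeRep N) e β x μ x₀ w hXs
    (k := fun t => ⟨NormedSpace.exp (t • X), hmem t⟩) (fun a b => Subtype.ext ?_) (fun t => ?_)
  · change NormedSpace.exp ((a + b) • X) = NormedSpace.exp (a • X) * NormedSpace.exp (b • X)
    rw [add_smul]
    exact Matrix.exp_add_of_commute _ _ (((Commute.refl X).smul_left a).smul_right b)
  · change NormedSpace.exp (t • X) = NormedSpace.exp ((t : ℂ) • X)
    rw [Complex.coe_smul]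

/-- **THE SINGLE-LINK LOOP EQUATION FOR LATTICE `SU(N)` YANG–MILLS ON A PERIODIC LATTICE** (Wilson
action; any finite additive site group `A` with translations `e` — the cubic torus and the 45°-tilted
box are instances; any real `β`; `s = 1`). For every link `(x, μ)` and every lattice word `w` closed at
`x`: `Σ_k E[splitTerm_k] + (β/2)·Σ_{ν≠μ,ε=±} E[plaqTerm_{ν,ε}] = 0` with `E` the expectation in
`gibbs (fundamentalRep (Fin N)) e β` (`β = β_tree = β_std/N`). Dividing by `N²` (`W := tr/N`,
`1/λ := β/(2N)`) this is Kazakov–Zheng's `A_id + A_var + A_split + A_join = 0` (arXiv:2404.16925 §2.3;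
JHEP 03 (2025) 099 (2.26)). Unconditional: a theorem about the finite
periodic lattice. [folklore] -/
theorem loopEquation_specialUnitaryGroup (N : ℕ) (e : Fin d → A) (β : ℝ) (x : A) (μ : Fin d)
    (w : Word d) (hw : Word.endpoint e x w = x) :
    (∑ k ∈ Finset.range w.length, ∫ U, splitTerm (fundamentalRep (Fin N)) e 1 x μ U w k
        ∂(gibbs (fundamentalRep (Fin N)) e β)) +
      (β / 2 : ℂ) * ∑ ν ∈ Finset.univ.erase μ, ∑ ε : Bool,
        ∫ U, plaqTerm (fundamentalRep (Fin N)) e 1 x μ U w ν ε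
          ∂(gibbs (fundamentalRep (Fin N)) e β) = 0 :=
  loopEquation_of_sdPair e (fundamentalLatticeRep N) β x μ 1 w hw
    fun i j => sdPair_specialUnitaryGroup N e β x μ x w _ (trace_unitDir_one i j)

/-- **THE SINGLE-LINK LOOP EQUATION FOR LATTICE `U(N)` ON A PERIODIC LATTICE** (`s = 0`: no `1/N²` and
no double-trace plaquette terms). [folklore] -/
theorem loopEquation_unitaryGroup (N : ℕ) (e : Fin d → A) (β : ℝ) (x : A) (μ : Fin d) (w : Word d)
    (hw : Word.endpoint e x w = x) :
    (∑ k ∈ Finset.range w.length, ∫ U, splitTerm (unitaryFundamentalRep (Fin N) ℂ) e 0 x μ U w k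
        ∂(gibbs (unitaryFundamentalRep (Fin N) ℂ) e β)) +
      (β / 2 : ℂ) * ∑ ν ∈ Finset.univ.erase μ, ∑ ε : Bool,
        ∫ U, plaqTerm (unitaryFundamentalRep (Fin N) ℂ) e 0 x μ U w ν ε
          ∂(gibbs (unitaryFundamentalRep (Fin N) ℂ) e β) = 0 :=
  loopEquation_of_sdPair e (unitaryFundamentalLatticeRep N) β x μ 0 w hw
    fun _ _ => sdPair_unitaryGroup N e β x μ x w _

end Concrete

end TiltedRP

end Summit.QuantumFields.GaugeBoot

end
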